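import Summits.QuantumFields.BalabanUV.Beta.GAN24.DirichletRingHessianIdentity
import Summits.QuantumFields.BalabanUV.Beta.GAN24.DirichletBoxTrace

/-!
# `BalabanUV.Beta.GAN24.DirichletVertexChart` — binder row G-an2-4 / (CONV-C), road P2 PART IV, leaf L14 (the torus transfer), FILE A:
# THE CHART OF A RE-ENTRANT BLOCK VERTEX — model square `ℤ²` ↔ torus `Tor (fine n M)` in `d = 2` (unit b2b-balaban-gan24-p2, gen 26, v1)

HONEST FRAMING (cell contract, verbatim): «discharging `BetaPertH` makes Bałaban's UV stability UNCONDITIONAL — a real constructive-QFT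
result; it is NOT the continuum limit and NOT the Clay problem.»  SUPPLIER module under the T⁴-DAG sub-row `T4-U1a.S-NE2-D1-DIRICHLET°`
(holder: the t4-ne2-p1 lineage; owner wording R24 «the full rate L⁻¹ beyond boxes OPEN»).  The d = 2 programme of memo
`HOME/b2b-balaban-gan24-p2/gen24/W-FULL-WEIGHTED.md` §3 is complete AT MODEL LEVEL (one re-entrant vertex of the plane lattice `ℤ²`, lattice
units): the ring lemma D₂ `DirichletRingDecay.ring_energy_decay`, binder (B) `DirichletRingWeighted.weighted_ring_energy_le`, binder (A)
`DirichletRingHessian.weighted_hessian_le` — all for a field `U : ℤ → ℤ → ℂ` vanishing on the quadrant `{0 ≤ i} × {0 ≤ j}` (`hU`) and solving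
`lap U = G` on `[−n, n)² ∖ quadrant` (`hEq`).  Leaf L14 carries them to the torus `Tor (fine n M)` (`n` sites per unit block, `M_ν` blocks,
`d = 2`) around every re-entrant vertex of a union of unit blocks `Ω = blockReg n M S`.  THIS FILE is the chart bookkeeping (memo
`gen25/RING-LEMMA-KERNEL.md` §7 items (a), (b), (e): the chart, no wrap, the blocks, the dictionary); the truncation lemmas (`hU`, `hEq`, bond
comparison), the sum comparisons (c), (d) and the binders on the torus are the next files (`DirichletVertexPullback`, …).

## Contents ([folklore] `ZMod` arithmetic on the tree's torus; 0 sorry)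

* §1 the chart `emb σ b : ℤ → ℤ → Tor (fine n M)` of the block vertex `n·b` (`b : Tor M`) with ORIENTATION `σ : Fin 2 → Bool`:
  `(emb σ b i j) ν = n·b_ν + crd σ ν (i, j)_ν (mod n·M_ν)`, `crd = id` if `σ ν` else `x ↦ −1 − x` — so that ALL FOUR orientations of a
  re-entrant vertex are read in the one model geometry of the ring files; neighbour lemmas `emb (i±1) j = emb i j ± sgnVec σ 0` etc. and the
  unordered-pair form `nbrs_fst/snd` (symmetric stencils do not see the orientation).
* §2 NO WRAP: `emb` is injective on every box `[a₀, a₀+W₀) × [a₁, a₁+W₁)` with `W_ν ≤ n·M_ν` (`emb_injOn`).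
* §3 the four blocks of the vertex star `starBlk σ b p` (`p` = sign pattern), **`blockOf_emb`**: `blockOf (emb σ b i j) = starBlk σ b (sgnPat i j)`
  on `[−n, n)²`; `ReentrantAt S σ b` := the quadrant block is NOT in `S`, the other three are; hence quadrant window sites are outside `Ω`
  (`not_blockReg_emb`) and off-quadrant window sites inside (`blockReg_emb`).
* §4 the periodic pull-back `Up u (i, j) = u (emb σ b i j)` and the truncated one `Uc u = 𝟙_{off-quadrant}·Up u`; the DICTIONARY
  `(LapS u)(emb i j) = n²·lap (Up u) (i,j)`, `(Pdir u μ)(emb i j) = −n²·d_μ (Up u) (i,j)`, `‖(sdiff u μ)(emb i j)‖² = n²·(one model bond of Up u)`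
  (exact, orientation-dependent) and `≤ n²·(the two model bonds at (i,j))` (orientation-free).

ABSOLUTE RULE (cell, verbatim): «No internally-minted statement may enter as a cited fact. Every hypothesis is either kernel-proved in
this package or a verbatim quotation of a PUBLISHED theorem with page reference. The manuscript(s) under audit are NOT citable for
their own disputed steps — they are the thing under adjudication; programme-internal (2001/route/tribunal) claims are never citable.»
Nothing printed is a hypothesis; no estimate of any Bałaban object is made here.  NOT CLAIMED: (A)/(B) on the torus (next files), the
weighted END p234489 (CONDITIONAL), the vector layer, NE2, (CONV-C) as a whole, `BetaPertH`, continuum, Clay.  «not in print; our proof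
attempt».  HONEST DEPENDENCY: continuum YM on T⁴ ⇐ BetaPertH ∧ nine spine estimates (0/9 proved); BetaPertH ⇐ (D1) ∧ (D4) ∧ CAP+tail;
G-an2-4 gates asym, D1 and NE2/3/4.
-/

noncomputable section

open scoped BigOperators ComplexConjugate Matrix
open Finset

namespace Summit.QuantumFields.BalabanUV.Beta.GAN24.DirichletVertexChart

open Literature.MathematicalPhysics.QuantumFieldTheory.Balaban1983to89.B5Prop11Plancherel (Tor fine unitVec)
open Literature.MathematicalPhysics.QuantumFieldTheory.Balaban1983to89.B5Action121 (sdiff LapS sdiff_mulVec LapS_mulVec)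
open Literature.MathematicalPhysics.QuantumFieldTheory.Balaban1983to89.B5Block118 (bpt iota up upHom_intCast)
open Literature.MathematicalPhysics.QuantumFieldTheory.Balaban1983to89.B5Blocks16 (blockOf blockOf_bpt)
open Summit.QuantumFields.BalabanUV.Beta.GAN24.DirichletBoxRegularity (Pdir Pdir_mulVec)
open Summit.QuantumFields.BalabanUV.Beta.GAN24.DirichletBoxTrace (blockReg)
open DirichletRingEnergies (hb vb lap)
open DirichletRingHessianIdentity (d1 d2)

variable (n : ℕ) [NeZero n] (M : Fin 2 → ℕ) [hM : ∀ μ, NeZero (M μ)]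

/-! ## §1 The chart of a block vertex with an orientation -/

/-- the affine coordinate of axis `ν` under the orientation `σ`: the identity if `σ ν`, the reflection `x ↦ −1 − x` otherwise
(so that the model half-line `{0 ≤ x}` is carried onto `{0 ≤ x}` resp. `{x ≤ −1}`). [folklore] -/
def crd (σ : Fin 2 → Bool) (ν : Fin 2) (x : ℤ) : ℤ := if σ ν then x else -1 - x

/-- the model coordinates of the site `(i, j)` as a function on `Fin 2`. [folklore] -/
def cvec (i j : ℤ) : Fin 2 → ℤ := ![i, j]

/-- **THE CHART** of the block vertex `n·b` with orientation `σ`: the model site `(i, j) ∈ ℤ²` is sent to the torus site with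
`ν`-coordinate `n·b_ν + crd σ ν (i, j)_ν (mod n·M_ν)`. [folklore] -/
def emb (σ : Fin 2 → Bool) (b : Tor M) (i j : ℤ) : Tor (fine n M) :=
  fun ν => (((n : ℤ) * ((b ν).val : ℤ) + crd σ ν (cvec i j ν) : ℤ) : ZMod (fine n M ν))

/-- the oriented unit vector of axis `ν`: `+e_ν` if `σ ν`, `−e_ν` otherwise. [folklore] -/
def sgnVec (σ : Fin 2 → Bool) (ν : Fin 2) : Tor (fine n M) := if σ ν then unitVec (fine n M) ν else -unitVec (fine n M) ν

omit [NeZero n] hM in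
/-- `cvec (i+1) j = cvec i j + δ_0`. [folklore] -/
theorem cvec_succ_fst (i j : ℤ) (ν : Fin 2) : cvec (i + 1) j ν = cvec i j ν + if ν = 0 then 1 else 0 := by
  fin_cases ν <;> simp [cvec]

omit [NeZero n] hM in
/-- `cvec i (j+1) = cvec i j + δ_1`. [folklore] -/
theorem cvec_succ_snd (i j : ℤ) (ν : Fin 2) : cvec i (j + 1) ν = cvec i j ν + if ν = 1 then 1 else 0 := by
  fin_cases ν <;> simp [cvec]

omit [NeZero n] hM in
/-- `crd` is affine with slope `±1`: `crd σ ν (x + 1) = crd σ ν x ± 1`. [folklore] -/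
theorem crd_add_one (σ : Fin 2 → Bool) (ν : Fin 2) (x : ℤ) : crd σ ν (x + 1) = crd σ ν x + if σ ν then 1 else -1 := by
  unfold crd; split_ifs <;> ring

omit [NeZero n] hM in
/-- the coordinates of a chart site. [folklore] -/
theorem emb_apply (σ : Fin 2 → Bool) (b : Tor M) (i j : ℤ) (ν : Fin 2) :
    emb n M σ b i j ν = (((n : ℤ) * ((b ν).val : ℤ) + crd σ ν (cvec i j ν) : ℤ) : ZMod (fine n M ν)) := rfl

omit [NeZero n] hM in
/-- the coordinates of the oriented unit vector. [folklore] -/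
theorem sgnVec_apply (σ : Fin 2 → Bool) (μ ν : Fin 2) :
    sgnVec n M σ μ ν = if ν = μ then (if σ μ then (1 : ZMod (fine n M ν)) else -1) else 0 := by
  unfold sgnVec unitVec
  by_cases h : ν = μ
  · subst h; rw [if_pos rfl]; split_ifs <;> simp
  · rw [if_neg h]; split_ifs <;> simp [h]

omit [NeZero n] hM in
/-- **neighbours, first axis**: `emb (i+1) j = emb i j + sgnVec σ 0`. [folklore] -/
theorem emb_succ_fst (σ : Fin 2 → Bool) (b : Tor M) (i j : ℤ) : emb n M σ b (i + 1) j = emb n M σ b i j + sgnVec n M σ 0 := by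
  funext ν
  rw [Pi.add_apply, emb_apply, emb_apply, cvec_succ_fst, sgnVec_apply]
  by_cases hν : ν = 0
  · subst hν
    rw [if_pos rfl, if_pos rfl, crd_add_one]
    split_ifs <;> push_cast <;> ring
  · rw [if_neg hν, if_neg hν, add_zero, add_zero]

omit [NeZero n] hM in
/-- **neighbours, second axis**: `emb i (j+1) = emb i j + sgnVec σ 1`. [folklore] -/
theorem emb_succ_snd (σ : Fin 2 → Bool) (b : Tor M) (i j : ℤ) : emb n M σ b i (j + 1) = emb n M σ b i j + sgnVec n M σ 1 := by
  funext ν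
  rw [Pi.add_apply, emb_apply, emb_apply, cvec_succ_snd, sgnVec_apply]
  by_cases hν : ν = 1
  · subst hν
    rw [if_pos rfl, if_pos rfl, crd_add_one]
    split_ifs <;> push_cast <;> ring
  · rw [if_neg hν, if_neg hν, add_zero, add_zero]

omit [NeZero n] hM in
/-- `emb (i−1) j = emb i j − sgnVec σ 0`. [folklore] -/
theorem emb_pred_fst (σ : Fin 2 → Bool) (b : Tor M) (i j : ℤ) : emb n M σ b (i - 1) j = emb n M σ b i j - sgnVec n M σ 0 := by
  rw [eq_sub_iff_add_eq, ← emb_succ_fst, sub_add_cancel]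

omit [NeZero n] hM in
/-- `emb i (j−1) = emb i j − sgnVec σ 1`. [folklore] -/
theorem emb_pred_snd (σ : Fin 2 → Bool) (b : Tor M) (i j : ℤ) : emb n M σ b i (j - 1) = emb n M σ b i j - sgnVec n M σ 1 := by
  rw [eq_sub_iff_add_eq, ← emb_succ_snd, sub_add_cancel]

omit [NeZero n] hM in
/-- the two `ν`-neighbours of a chart site are the chart images of the two model `ν`-neighbours (as an unordered pair):
`{x + e_0, x − e_0} = {emb (i+1) j, emb (i−1) j}` in the sense needed for symmetric stencils. [folklore] -/
theorem nbrs_fst (σ : Fin 2 → Bool) (b : Tor M) (i j : ℤ) (g : Tor (fine n M) → ℂ) :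
    g (emb n M σ b i j + unitVec (fine n M) 0) + g (emb n M σ b i j - unitVec (fine n M) 0)
      = g (emb n M σ b (i + 1) j) + g (emb n M σ b (i - 1) j) := by
  rw [emb_succ_fst, emb_pred_fst, sgnVec]
  split_ifs
  · rfl
  · rw [← sub_eq_add_neg, sub_neg_eq_add, add_comm]

omit [NeZero n] hM in
/-- the same along the second axis. [folklore] -/
theorem nbrs_snd (σ : Fin 2 → Bool) (b : Tor M) (i j : ℤ) (g : Tor (fine n M) → ℂ) :
    g (emb n M σ b i j + unitVec (fine n M) 1) + g (emb n M σ b i j - unitVec (fine n M) 1)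
      = g (emb n M σ b i (j + 1)) + g (emb n M σ b i (j - 1)) := by
  rw [emb_succ_snd, emb_pred_snd, sgnVec]
  split_ifs
  · rfl
  · rw [← sub_eq_add_neg, sub_neg_eq_add, add_comm]

/-! ## §2 No wrap: the chart is injective on boxes of side at most `n·M_ν` -/

omit [NeZero n] hM in
/-- equal chart sites have model coordinates congruent modulo the torus periods `n·M_ν`. [folklore] -/
theorem modEq_of_emb_eq {σ : Fin 2 → Bool} {b : Tor M} {i j i' j' : ℤ} (h : emb n M σ b i j = emb n M σ b i' j') (ν : Fin 2) :
    cvec i j ν ≡ cvec i' j' ν [ZMOD ((fine n M ν : ℕ) : ℤ)] := by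
  have hν := congrFun h ν
  rw [emb_apply, emb_apply, ZMod.intCast_eq_intCast_iff] at hν
  have h2 := Int.ModEq.add_left_cancel' _ hν
  unfold crd at h2
  split_ifs at h2
  · exact h2
  · rw [sub_eq_add_neg, sub_eq_add_neg] at h2
    have h3 := (Int.ModEq.add_left_cancel' _ h2).neg
    rwa [neg_neg, neg_neg] at h3

omit [NeZero n] hM in
/-- two congruent integers in a common half-open interval of length at most the modulus are equal. [folklore] -/
theorem eq_of_modEq_of_mem {m : ℕ} {a x x' : ℤ} {W : ℕ} (hW : (W : ℤ) ≤ m) (hx : a ≤ x) (hx' : x < a + W) (hy : a ≤ x')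
    (hy' : x' < a + W) (h : x ≡ x' [ZMOD (m : ℤ)]) : x = x' := by
  have hd : (m : ℤ) ∣ x' - x := h.dvd
  have habs : |x' - x| < m := by rw [abs_lt]; constructor <;> omega
  have := Int.eq_zero_of_abs_lt_dvd hd habs
  omega

omit [NeZero n] hM in
/-- **NO WRAP**: on a box `[a₀, a₀ + W₀) × [a₁, a₁ + W₁)` with `W_ν ≤ n·M_ν` the chart is injective. [folklore] -/
theorem emb_injOn {σ : Fin 2 → Bool} {b : Tor M} {a₀ a₁ : ℤ} {W₀ W₁ : ℕ} (hW₀ : W₀ ≤ n * M 0) (hW₁ : W₁ ≤ n * M 1)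
    {i j i' j' : ℤ} (hi : a₀ ≤ i) (hi2 : i < a₀ + W₀) (hj : a₁ ≤ j) (hj2 : j < a₁ + W₁)
    (hi' : a₀ ≤ i') (hi2' : i' < a₀ + W₀) (hj' : a₁ ≤ j') (hj2' : j' < a₁ + W₁)
    (h : emb n M σ b i j = emb n M σ b i' j') : i = i' ∧ j = j' := by
  have h0 := modEq_of_emb_eq n M h 0
  have h1 := modEq_of_emb_eq n M h 1
  simp only [cvec, Fin.isValue, Matrix.cons_val_zero, Matrix.cons_val_one] at h0 h1
  exact ⟨eq_of_modEq_of_mem (m := fine n M 0) (by exact_mod_cast hW₀) hi hi2 hi' hi2' h0,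
    eq_of_modEq_of_mem (m := fine n M 1) (by exact_mod_cast hW₁) hj hj2 hj' hj2' h1⟩

/-! ## §3 The four blocks of the vertex star; re-entrant vertices -/

/-- the block of the vertex star at `n·b` that contains the chart image of the model quadrant with sign pattern `p`
(`p ν = true` ↔ nonnegative model coordinate along `ν`): block coordinate `b_ν` if `p ν = σ ν`, else `b_ν − 1`. [folklore] -/
def starBlk (σ : Fin 2 → Bool) (b : Tor M) (p : Fin 2 → Bool) : Tor M :=
  fun ν => b ν - (if p ν = σ ν then (0 : ZMod (M ν)) else 1)

/-- the sign pattern of a model site. [folklore] -/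
def sgnPat (i j : ℤ) : Fin 2 → Bool := fun ν => decide (0 ≤ cvec i j ν)

omit [NeZero n] hM in
/-- the in-block offset of the coordinate `x ∈ [−n, n)`: `crd σ ν x` if that is in `[0,n)`, else `crd σ ν x + n`; it lies in `[0, n)`. [folklore] -/
theorem offset_range (σ : Fin 2 → Bool) (ν : Fin 2) {x : ℤ} (hx : -(n : ℤ) ≤ x) (hx' : x < n) :
    0 ≤ crd σ ν x + (if decide (0 ≤ x) = σ ν then 0 else (n : ℤ))
      ∧ crd σ ν x + (if decide (0 ≤ x) = σ ν then 0 else (n : ℤ)) < n := by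
  unfold crd
  by_cases h0 : 0 ≤ x
  · cases hσ : σ ν <;> simp [h0] <;> omega
  · cases hσ : σ ν <;> simp [h0] <;> omega

/-- **THE BLOCK OF A CHART SITE**: for `(i, j) ∈ [−n, n)²`, `blockOf (emb σ b i j) = starBlk σ b (sgnPat i j)`. [folklore] -/
theorem blockOf_emb (σ : Fin 2 → Bool) (b : Tor M) {i j : ℤ} (hi : -(n : ℤ) ≤ i) (hi' : i < n) (hj : -(n : ℤ) ≤ j) (hj' : j < n) :
    blockOf n M (emb n M σ b i j) = starBlk M σ b (sgnPat i j) := by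
  -- the offsets
  have hrng : ∀ ν, -(n : ℤ) ≤ cvec i j ν ∧ cvec i j ν < n := by
    intro ν; fin_cases ν
    · exact ⟨hi, hi'⟩
    · exact ⟨hj, hj'⟩
  set o : Fin 2 → Fin n := fun ν =>
    ⟨(crd σ ν (cvec i j ν) + (if decide (0 ≤ cvec i j ν) = σ ν then 0 else (n : ℤ))).toNat, by
      have h := offset_range n σ ν (hrng ν).1 (hrng ν).2
      omega⟩ with ho
  have he : emb n M σ b i j = bpt n M (starBlk M σ b (sgnPat i j)) o := by
    funext ν
    have h := offset_range n σ ν (hrng ν).1 (hrng ν).2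
    have hoν : ((o ν : ℕ) : ℤ) = crd σ ν (cvec i j ν) + (if decide (0 ≤ cvec i j ν) = σ ν then 0 else (n : ℤ)) := by
      rw [ho]; simp only; omega
    rw [emb_apply, bpt]
    show _ = up n M (starBlk M σ b (sgnPat i j)) ν + iota n M o ν
    rw [up, iota, starBlk, sgnPat]
    have e1 : (b ν - if decide (0 ≤ cvec i j ν) = σ ν then (0 : ZMod (M ν)) else 1)
        = (((((b ν).val : ℤ) - if decide (0 ≤ cvec i j ν) = σ ν then (0 : ℤ) else 1) : ℤ) : ZMod (M ν)) := by
      split_ifs <;> simp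
    have e2 : (((o ν : ℕ) : ℕ) : ZMod (fine n M ν)) = (((o ν : ℕ) : ℤ) : ZMod (fine n M ν)) := by rw [Int.cast_natCast]
    rw [e1, upHom_intCast, e2, hoν]
    split_ifs <;> push_cast <;> ring
  rw [he, blockOf_bpt]

/-- [shape] **RE-ENTRANT VERTEX** `(σ, b)` of the block set `S`: the quadrant block of the star is NOT in `S`, the three others are. [folklore] -/
def ReentrantAt (S : Tor M → Prop) (σ : Fin 2 → Bool) (b : Tor M) : Prop :=
  ¬ S (starBlk M σ b fun _ => true) ∧ ∀ p : Fin 2 → Bool, p ≠ (fun _ => true) → S (starBlk M σ b p)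

variable {S : Tor M → Prop}

/-- quadrant sites of the window are OUTSIDE the block region: `(i, j) ∈ [0, n)² ⟹ emb σ b i j ∉ Ω`. [folklore] -/
theorem not_blockReg_emb {σ : Fin 2 → Bool} {b : Tor M} (hre : ReentrantAt M S σ b) {i j : ℤ} (hi : 0 ≤ i) (hi' : i < n)
    (hj : 0 ≤ j) (hj' : j < n) : ¬ blockReg n M S (emb n M σ b i j) := by
  unfold blockReg
  rw [blockOf_emb n M σ b (by omega) hi' (by omega) hj']
  have hp : sgnPat i j = fun _ => true := by
    funext ν; fin_cases ν <;> simp [sgnPat, cvec, hi, hj]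
  rw [hp]
  exact hre.1

/-- off-quadrant sites of the window are INSIDE the block region: `(i, j) ∈ [−n, n)² ∖ Q ⟹ emb σ b i j ∈ Ω`. [folklore] -/
theorem blockReg_emb {σ : Fin 2 → Bool} {b : Tor M} (hre : ReentrantAt M S σ b) {i j : ℤ} (hi : -(n : ℤ) ≤ i) (hi' : i < n)
    (hj : -(n : ℤ) ≤ j) (hj' : j < n) (hq : ¬ (0 ≤ i ∧ 0 ≤ j)) : blockReg n M S (emb n M σ b i j) := by
  unfold blockReg
  rw [blockOf_emb n M σ b hi hi' hj hj']
  refine hre.2 _ fun h => hq ?_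
  have h0 := congrFun h 0
  have h1 := congrFun h 1
  simp only [sgnPat, cvec, Fin.isValue, Matrix.cons_val_zero, Matrix.cons_val_one, decide_eq_true_eq] at h0 h1
  exact ⟨h0, h1⟩

/-! ## §4 The pull-backs and the dictionary model ↔ torus -/

/-- the PERIODIC PULL-BACK of a torus field along the chart: `Up u (i, j) = u (emb σ b i j)`. [folklore] -/
def Up (σ : Fin 2 → Bool) (b : Tor M) (u : Tor (fine n M) → ℂ) (i j : ℤ) : ℂ := u (emb n M σ b i j)

/-- the TRUNCATED PULL-BACK: `Up u` off the model quadrant `{0 ≤ i} × {0 ≤ j}`, zero on it. [folklore] -/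
def Uc (σ : Fin 2 → Bool) (b : Tor M) (u : Tor (fine n M) → ℂ) (i j : ℤ) : ℂ :=
  if 0 ≤ i ∧ 0 ≤ j then 0 else u (emb n M σ b i j)

omit [NeZero n] hM in
/-- `hU`: the truncated pull-back vanishes on the quadrant (by definition, for every torus field). [folklore] -/
theorem Uc_quadrant (σ : Fin 2 → Bool) (b : Tor M) (u : Tor (fine n M) → ℂ) :
    ∀ s t : ℤ, 0 ≤ s → 0 ≤ t → Uc n M σ b u s t = 0 := fun _ _ hs ht => by
  rw [Uc, if_pos ⟨hs, ht⟩]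

omit [NeZero n] hM in
/-- off the quadrant the two pull-backs agree. [folklore] -/
theorem Uc_of_not (σ : Fin 2 → Bool) (b : Tor M) (u : Tor (fine n M) → ℂ) {i j : ℤ} (h : ¬ (0 ≤ i ∧ 0 ≤ j)) :
    Uc n M σ b u i j = Up n M σ b u i j := by
  rw [Uc, if_neg h, Up]

/-- **DICTIONARY, Laplacian**: `(Δ u)(emb σ b i j) = n²·lap (Up u) (i, j)` (`Δ = LapS` with lattice factor `n`, `lap` the 5-point stencil). [folklore] -/
theorem LapS_emb (σ : Fin 2 → Bool) (b : Tor M) (u : Tor (fine n M) → ℂ) (i j : ℤ) :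
    (LapS (fine n M) (n : ℂ) *ᵥ u) (emb n M σ b i j) = (n : ℂ) ^ 2 * lap (Up n M σ b u) i j := by
  rw [LapS_mulVec, Fin.sum_univ_two, Complex.conj_natCast, lap]
  simp only [Up]
  have h0 := nbrs_fst n M σ b i j u
  have h1 := nbrs_snd n M σ b i j u
  linear_combination ((n : ℂ) * n) * (-h0 - h1)

/-- **DICTIONARY, second differences**: `(∂₀ᴴ∂₀ u)(emb σ b i j) = −n²·d1 (Up u) (i, j)`. [folklore] -/
theorem Pdir_emb_fst (σ : Fin 2 → Bool) (b : Tor M) (u : Tor (fine n M) → ℂ) (i j : ℤ) :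
    (Pdir (fine n M) (n : ℂ) 0 *ᵥ u) (emb n M σ b i j) = -(n : ℂ) ^ 2 * d1 (Up n M σ b u) i j := by
  rw [Pdir_mulVec, Complex.conj_natCast, d1]
  simp only [Up]
  have h0 := nbrs_fst n M σ b i j u
  linear_combination (-(n : ℂ) * n) * h0

/-- `(∂₁ᴴ∂₁ u)(emb σ b i j) = −n²·d2 (Up u) (i, j)`. [folklore] -/
theorem Pdir_emb_snd (σ : Fin 2 → Bool) (b : Tor M) (u : Tor (fine n M) → ℂ) (i j : ℤ) :
    (Pdir (fine n M) (n : ℂ) 1 *ᵥ u) (emb n M σ b i j) = -(n : ℂ) ^ 2 * d2 (Up n M σ b u) i j := by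
  rw [Pdir_mulVec, Complex.conj_natCast, d2]
  simp only [Up]
  have h1 := nbrs_snd n M σ b i j u
  linear_combination (-(n : ℂ) * n) * h1

/-- **DICTIONARY, first differences**: `‖(∂₀ u)(emb σ b i j)‖² = n²·hb (Up u) (i, j)` if `σ 0`, `= n²·hb (Up u) (i−1, j)` otherwise
(the torus bond at the chart site is the model bond to the right resp. to the left). [folklore] -/
theorem normSq_sdiff_emb_fst (σ : Fin 2 → Bool) (b : Tor M) (u : Tor (fine n M) → ℂ) (i j : ℤ) :
    ‖(sdiff (fine n M) (n : ℂ) 0 *ᵥ u) (emb n M σ b i j)‖ ^ 2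
      = (n : ℝ) ^ 2 * (if σ 0 then hb (Up n M σ b u) i j else hb (Up n M σ b u) (i - 1) j) := by
  rw [sdiff_mulVec, norm_mul, Complex.norm_natCast, mul_pow]
  congr 1
  split_ifs with h
  · rw [hb, Up, Up, emb_succ_fst, sgnVec, if_pos h]
  · rw [hb, Up, Up, sub_add_cancel, emb_pred_fst, sgnVec, if_neg h, sub_neg_eq_add, norm_sub_rev]

/-- `‖(∂₁ u)(emb σ b i j)‖² = n²·vb (Up u) (i, j)` if `σ 1`, `= n²·vb (Up u) (i, j−1)` otherwise. [folklore] -/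
theorem normSq_sdiff_emb_snd (σ : Fin 2 → Bool) (b : Tor M) (u : Tor (fine n M) → ℂ) (i j : ℤ) :
    ‖(sdiff (fine n M) (n : ℂ) 1 *ᵥ u) (emb n M σ b i j)‖ ^ 2
      = (n : ℝ) ^ 2 * (if σ 1 then vb (Up n M σ b u) i j else vb (Up n M σ b u) i (j - 1)) := by
  rw [sdiff_mulVec, norm_mul, Complex.norm_natCast, mul_pow]
  congr 1
  split_ifs with h
  · rw [vb, Up, Up, emb_succ_snd, sgnVec, if_pos h]
  · rw [vb, Up, Up, sub_add_cancel, emb_pred_snd, sgnVec, if_neg h, sub_neg_eq_add, norm_sub_rev]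

/-- the orientation-free bound `‖(∂₀ u)(emb σ b i j)‖² ≤ n²·(hb (Up u) (i, j) + hb (Up u) (i−1, j))`. [folklore] -/
theorem normSq_sdiff_emb_fst_le (σ : Fin 2 → Bool) (b : Tor M) (u : Tor (fine n M) → ℂ) (i j : ℤ) :
    ‖(sdiff (fine n M) (n : ℂ) 0 *ᵥ u) (emb n M σ b i j)‖ ^ 2
      ≤ (n : ℝ) ^ 2 * (hb (Up n M σ b u) i j + hb (Up n M σ b u) (i - 1) j) := by
  rw [normSq_sdiff_emb_fst]
  have h1 := DirichletRingEnergies.hb_nonneg (Up n M σ b u) i j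
  have h2 := DirichletRingEnergies.hb_nonneg (Up n M σ b u) (i - 1) j
  refine mul_le_mul_of_nonneg_left ?_ (sq_nonneg _)
  split_ifs <;> linarith

/-- `‖(∂₁ u)(emb σ b i j)‖² ≤ n²·(vb (Up u) (i, j) + vb (Up u) (i, j−1))`. [folklore] -/
theorem normSq_sdiff_emb_snd_le (σ : Fin 2 → Bool) (b : Tor M) (u : Tor (fine n M) → ℂ) (i j : ℤ) :
    ‖(sdiff (fine n M) (n : ℂ) 1 *ᵥ u) (emb n M σ b i j)‖ ^ 2
      ≤ (n : ℝ) ^ 2 * (vb (Up n M σ b u) i j + vb (Up n M σ b u) i (j - 1)) := by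
  rw [normSq_sdiff_emb_snd]
  have h1 := DirichletRingEnergies.vb_nonneg (Up n M σ b u) i j
  have h2 := DirichletRingEnergies.vb_nonneg (Up n M σ b u) i (j - 1)
  refine mul_le_mul_of_nonneg_left ?_ (sq_nonneg _)
  split_ifs <;> linarith

end Summit.QuantumFields.BalabanUV.Beta.GAN24.DirichletVertexChart

end
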